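import Summits.QuantumFields.YangMills.Theorems.LuscherReductionDressedRitzPlateauSpreadFree
import HarnessLib

/-!
# Route `LuscherReduction`, item `DressedRitz` (stmt-QuantumFields-20205) — the ORDER clause (o1) of the operator-language cut is FREE:
# `OperatorPlateauAt k` from (o0), (o2), (o4), (o5), (o6) (Lipschitz sorting of the one-step effective masses)

Support module of the `FemtoTransferGap` group (LEAD prover ym-lead-20205-polyakovlift g0 of line «polyakovlift» on the crux child `DressedRitz` =
stmt-QuantumFields-20205 of RED stmt-QuantumFields-19978; route `LuscherReduction`, femto rung R2b1).  Companion of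
`…DressedRitzPlateauSpreadFree.lean` (ym-infvol-p2 g6), which struck the SPREAD clause (o7); this file strikes the ORDER clause (o1) as well, so a
prover of item 20205 through the operator-language cut `OpPlat.OperatorPlateauAt k` delivers only (o0) `n_i > 0`, (o2) near-orthogonality,
(o4) single-state dominance, (o5) Lüscher position and (o6) symmetrised couplings — for insertions in ANY order.

WHY IT IS FREE.  Write `ρ_i = d_ii/n_i` for the one-step effective ratios.  The Lüscher position (o5) confines `ρ_i` to the band
`[a_i, b_i] = [e^{−δ}μ_{i+1}λ₀/μ₀, e^{δ}μ_{i+1}λ₀/μ₀]` (`δ = Cλ²/L`), whose two edges are ANTITONE in `i` because the one-site levels `μ_j(B)` are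
non-increasing in `j` (`levelValue_le_of_le`).  LIPSCHITZ SORTING (`antitone_perm_mem_band`, pigeonhole): the non-increasing rearrangement
`ρ ∘ τ` of any sequence lying in a band with antitone edges lies in the same band — if `ρ_{τi} > b_i` then the `i+1` indices `τ0 … τi` all
carry values `> b_i ≥ b_j` (`j ≥ i`), so each is an index `< i`: `i+1` values injected into `i` slots.  Hence relabelling the insertions by `τ`
gives (o1) `ρ_{τl} ≤ ρ_{τi}` (`i ≤ l`) and KEEPS (o5) with the same labels `i ↦ μ_{i+1}`; (o0), (o2), (o4), (o6) are relabelling-invariant.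

* `antitone_perm_mem_band` — the sorting lemma (any linear order, any `Fin k`-indexed family);
* `exists_perm_antitone` — a non-increasing rearrangement exists (`Tuple.sort`);
* `exists_perm_ordered_position` — pure-real form: ordered AND in position after a relabelling;
* ★ `operatorPlateauAt_of_unorderedCore : (OperatorPlateauAt k with PlateauClauses minus (o1), (o7)) → OperatorPlateauAt k`.

HONEST FRAMING: fixed-lattice ∕ pure-real bookkeeping on the femto rung R2b1; proves nothing OF `DressedRitz` (the XL renormalisation-group
estimate); no bearing on infinite volume, the continuum limit or the Clay mass gap.  References: M. Lüscher, NPB 219 (1983) 233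
[cite: Luscher1983, §3]; M. Lüscher, U. Wolff, NPB 339 (1990) 222 [cite: LuscherWolff1990]; Reed–Simon IV, Thm. XIII.1 [cite: ReedSimonIV1978, Thm. XIII.1].
-/

set_option autoImplicit false

noncomputable section

open MeasureTheory Filter Topology Real
open Literature.MathematicalPhysics.QuantumFieldTheory
open Literature.MathematicalPhysics.QuantumLattice
open Literature.Analysis.OperatorTheory.YMMatrixModel
open scoped BigOperators

namespace Summit.QuantumFields.YangMills.Theorems.FemtoTransferGap.OpPlat

open Summit.QuantumFields.YangMills.Theorems.FemtoTransferGap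
open Summit.QuantumFields.YangMills.Theorems.FemtoTransferGap.KTGen
open Summit.QuantumFields.YangMills.Theorems.FemtoTransferGap.TraceDoor

/-! ## §1 Lipschitz sorting -/

/-- **LIPSCHITZ SORTING** (pigeonhole form): if `a ≤ r ≤ b` pointwise on `Fin k` with `a` and `b` antitone, then every antitone rearrangement
`r ∘ τ` satisfies `a ≤ r ∘ τ ≤ b` as well. [folklore] -/
theorem antitone_perm_mem_band {k : ℕ} {α : Type*} [LinearOrder α] {r a b : Fin k → α} (τ : Equiv.Perm (Fin k))
    (hτ : Antitone (r ∘ τ)) (ha : Antitone a) (hb : Antitone b) (hlo : ∀ i, a i ≤ r i) (hhi : ∀ i, r i ≤ b i)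
    (i : Fin k) : a i ≤ r (τ i) ∧ r (τ i) ≤ b i := by
  have hik : (i : ℕ) < k := i.2
  constructor
  · by_contra h
    rw [not_le] at h
    -- `τ` would map the `k − i` indices `≥ i` injectively into the `k − 1 − i` indices `> i`
    have hmaps : ∀ j ∈ Finset.Ici i, (τ : Fin k → Fin k) j ∈ Finset.Ioi i := by
      intro j hj
      rw [Finset.mem_Ici] at hj
      rw [Finset.mem_Ioi]
      have h1 : r (τ j) ≤ r (τ i) := hτ hj
      have h3 : a (τ j) < a i := lt_of_le_of_lt ((hlo (τ j)).trans h1) h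
      by_contra hle
      rw [not_lt] at hle
      exact absurd (ha hle) (not_le.mpr h3)
    have hcard := Finset.card_le_card_of_injOn (τ : Fin k → Fin k) hmaps τ.injective.injOn
    rw [Fin.card_Ici, Fin.card_Ioi] at hcard
    omega
  · by_contra h
    rw [not_le] at h
    -- `τ` would map the `i + 1` indices `≤ i` injectively into the `i` indices `< i`
    have hmaps : ∀ j ∈ Finset.Iic i, (τ : Fin k → Fin k) j ∈ Finset.Iio i := by
      intro j hj
      rw [Finset.mem_Iic] at hj
      rw [Finset.mem_Iio]
      have h1 : r (τ i) ≤ r (τ j) := hτ hj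
      have h3 : b i < b (τ j) := lt_of_lt_of_le (h.trans_le h1) (hhi (τ j))
      by_contra hle
      rw [not_lt] at hle
      exact absurd (hb hle) (not_le.mpr h3)
    have hcard := Finset.card_le_card_of_injOn (τ : Fin k → Fin k) hmaps τ.injective.injOn
    rw [Fin.card_Iic, Fin.card_Iio] at hcard
    omega

/-- Every real family on `Fin k` has an antitone (non-increasing) rearrangement (`Tuple.sort` of its negative). [folklore] -/
theorem exists_perm_antitone {k : ℕ} (r : Fin k → ℝ) : ∃ τ : Equiv.Perm (Fin k), Antitone (r ∘ τ) := by
  refine ⟨Tuple.sort (fun i => -r i), fun i j hij => ?_⟩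
  have h := Tuple.monotone_sort (fun i => -r i) hij
  simp only [Function.comp_apply, neg_le_neg_iff] at h
  exact h

/-- **SORTED LÜSCHER POSITION** (pure real): diagonal data `d_i`, norms `n_i > 0`, an antitone level sequence `m` (`m₀ > 0`), `λ₀ ≥ 0`, a
slack factor `E > 0`, and the two-sided position `d_i m₀ ≤ E (m_{i+1} λ₀) n_i`, `m_{i+1} λ₀ n_i ≤ E (d_i m₀)`; then some rearrangement `τ` is
ORDERED (`d_{τl} n_{τi} ≤ d_{τi} n_{τl}` for `i ≤ l`) and still in position with the SAME labels `i ↦ m_{i+1}`. [folklore] -/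
theorem exists_perm_ordered_position {k : ℕ} {d n : Fin k → ℝ} {m : ℕ → ℝ} {l0 m0 E : ℝ}
    (hn : ∀ i, 0 < n i) (hm0 : 0 < m0) (hl0 : 0 ≤ l0) (hE : 0 < E) (hm : Antitone m)
    (hA : ∀ i : Fin k, d i * m0 ≤ E * (m ((i : ℕ) + 1) * l0) * n i)
    (hB : ∀ i : Fin k, m ((i : ℕ) + 1) * l0 * n i ≤ E * (d i * m0)) :
    ∃ τ : Equiv.Perm (Fin k),
      (∀ i l : Fin k, i ≤ l → d (τ l) * n (τ i) ≤ d (τ i) * n (τ l)) ∧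
      (∀ i : Fin k, d (τ i) * m0 ≤ E * (m ((i : ℕ) + 1) * l0) * n (τ i)) ∧
      (∀ i : Fin k, m ((i : ℕ) + 1) * l0 * n (τ i) ≤ E * (d (τ i) * m0)) := by
  set ρ : Fin k → ℝ := fun i => d i / n i with hρ
  set a : Fin k → ℝ := fun i => m ((i : ℕ) + 1) * l0 / (E * m0) with ha
  set b : Fin k → ℝ := fun i => E * (m ((i : ℕ) + 1) * l0) / m0 with hb
  have hEm0 : 0 < E * m0 := mul_pos hE hm0
  have hmanti : ∀ i l : Fin k, i ≤ l → m ((l : ℕ) + 1) ≤ m ((i : ℕ) + 1) := fun i l hil =>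
    hm (Nat.succ_le_succ (Fin.le_def.mp hil))
  have haanti : Antitone a := fun i l hil =>
    div_le_div_of_nonneg_right (mul_le_mul_of_nonneg_right (hmanti i l hil) hl0) hEm0.le
  have hbanti : Antitone b := fun i l hil =>
    div_le_div_of_nonneg_right (mul_le_mul_of_nonneg_left (mul_le_mul_of_nonneg_right (hmanti i l hil) hl0) hE.le) hm0.le
  have hlo : ∀ i, a i ≤ ρ i := fun i => by
    rw [hρ, ha]
    dsimp only
    rw [le_div_iff₀ (hn i), div_mul_eq_mul_div, div_le_iff₀ hEm0]
    calc m ((i : ℕ) + 1) * l0 * n i ≤ E * (d i * m0) := hB i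
      _ = d i * (E * m0) := by ring
  have hhi : ∀ i, ρ i ≤ b i := fun i => by
    rw [hρ, hb]
    dsimp only
    rw [div_le_iff₀ (hn i), div_mul_eq_mul_div, le_div_iff₀ hm0]
    exact hA i
  obtain ⟨τ, hτ⟩ := exists_perm_antitone ρ
  have hband := antitone_perm_mem_band τ hτ haanti hbanti hlo hhi
  refine ⟨τ, fun i l hil => ?_, fun i => ?_, fun i => ?_⟩
  · have h : ρ (τ l) ≤ ρ (τ i) := hτ hil
    rw [hρ] at h
    dsimp only at h
    rwa [div_le_div_iff₀ (hn _) (hn _)] at h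
  · have h := (hband i).2
    rw [hρ, hb] at h
    dsimp only at h
    rwa [div_le_iff₀ (hn _), div_mul_eq_mul_div, le_div_iff₀ hm0] at h
  · have h := (hband i).1
    rw [hρ, ha] at h
    dsimp only at h
    rw [le_div_iff₀ (hn _), div_mul_eq_mul_div, div_le_iff₀ hEm0] at h
    calc m ((i : ℕ) + 1) * l0 * n (τ i) ≤ d (τ i) * (E * m0) := h
      _ = E * (d (τ i) * m0) := by ring

/-! ## §2 `OperatorPlateauAt k` from the unordered core (o0), (o2), (o4), (o5), (o6) -/

/-- ★ **`OperatorPlateauAt k` from (o0), (o2), (o4), (o5), (o6)**: the ORDER clause (o1) of `PlateauClauses` is obtained by relabelling the insertions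
along the non-increasing rearrangement of `d_ii/n_i` (Lipschitz sorting keeps (o5); the other clauses are relabelling-invariant), and the SPREAD
clause (o7) is the tree's `operatorPlateauAt_of_core` (crux ONE, closed).  The hypothesis is `OperatorPlateauAt k` with `PlateauClauses k C β u`
(`u_i := ins φ O_i`) replaced by its conjuncts (o0), (o2), (o4), (o5), (o6). [cite: LuscherWolff1990] [cite: Luscher1983, §3] -/
theorem operatorPlateauAt_of_unorderedCore {k : ℕ}
    (h : ∃ C lam0 : ℝ, 0 ≤ C ∧ 0 < lam0 ∧ ∀ lam : ℝ, 0 < lam → lam ≤ lam0 → ∃ L0 : ℕ,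
      ∀ (L : ℕ) [NeZero L], L0 ≤ L → ∀ β : ℝ, InFemtoWindow lam β L →
        ∃ φ : GaugeConfig 3 L SU2 → ℝ, IsPhys φ ∧ l2 φ φ = 1 ∧
          transferApply β φ = levelValue su2Rep L β 0 • φ ∧
        ∃ u : Fin k → (GaugeConfig 3 L SU2 → ℝ), (∃ O : Fin k → (GaugeConfig 3 L SU2 → ℝ),
            (∀ i, IsPhys (O i)) ∧ u = fun i => ins φ (O i)) ∧
          (∀ i : Fin k, 0 < l2 (u i) (u i)) ∧
          (∀ i l : Fin k, i ≠ l →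
            |l2 (u i) (u l)| ≤ C * luscherLambda β L * (Real.sqrt (l2 (u i) (u i)) * Real.sqrt (l2 (u l) (u l)))) ∧
          (∀ i : Fin k,
            l2 (transferApply β (u i)) (transferApply β (u i)) * l2 (u i) (u i) - l2 (u i) (transferApply β (u i)) ^ 2
              ≤ C * (luscherLambda β L ^ 3 / (L : ℝ) ^ 2) * levelValue su2Rep L β 0 ^ 2 * l2 (u i) (u i) ^ 2) ∧
          (∀ i : Fin k,
            l2 (u i) (transferApply β (u i)) * levelValue su2Rep 1 (oneSiteCoupling β L) 0 ≤
                Real.exp (C * luscherLambda β L ^ 2 / L) *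
                  (levelValue su2Rep 1 (oneSiteCoupling β L) ((i : ℕ) + 1) * levelValue su2Rep L β 0) * l2 (u i) (u i) ∧
            levelValue su2Rep 1 (oneSiteCoupling β L) ((i : ℕ) + 1) * levelValue su2Rep L β 0 * l2 (u i) (u i) ≤
                Real.exp (C * luscherLambda β L ^ 2 / L) *
                  (l2 (u i) (transferApply β (u i)) * levelValue su2Rep 1 (oneSiteCoupling β L) 0)) ∧
          (∀ i l : Fin k, i ≠ l →
            |l2 (u i) (transferApply β (u l)) -
                (l2 (u i) (transferApply β (u i)) / l2 (u i) (u i) + l2 (u l) (transferApply β (u l)) / l2 (u l) (u l)) / 2 *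
                  l2 (u i) (u l)|
              ≤ C * (luscherLambda β L ^ 2 / L) * levelValue su2Rep L β 0 *
                  (Real.sqrt (l2 (u i) (u i)) * Real.sqrt (l2 (u l) (u l))))) :
    OperatorPlateauAt k := by
  obtain ⟨C, lam0, hC0, hlam0, hC⟩ := h
  apply operatorPlateauAt_of_core
  refine ⟨C, lam0, hC0, hlam0, fun lam hlam hle => ?_⟩
  obtain ⟨L0, hL⟩ := hC lam hlam hle
  refine ⟨L0, fun L _ hL0 β hW => ?_⟩
  obtain ⟨φ, hφ, hφ1, hKφ, u, ⟨O, hO, rfl⟩, h0, h2, h4, h5, h6⟩ := hL L hL0 β hW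
  have hβ0 : (0 : ℝ) ≤ β := zero_le_one.trans hW.1
  have hLpos : (0 : ℝ) < L := Nat.cast_pos.mpr (NeZero.pos L)
  have hlpos : 0 < luscherLambda β L := luscherLambda_pos_of_window hlam hW
  have hBpos : 0 < oneSiteCoupling β L := by
    unfold oneSiteCoupling
    exact div_pos (mul_pos two_pos (pow_pos hLpos 3)) (pow_pos hlpos 3)
  have hμ0 : 0 < levelValue su2Rep 1 (oneSiteCoupling β L) 0 := levelValue_su2Rep_pos (L := 1) hBpos 0
  have hl0 : 0 ≤ levelValue su2Rep L β 0 := levelValue_su2Rep_nonneg L hβ0 0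
  have hE : 0 < Real.exp (C * luscherLambda β L ^ 2 / L) := Real.exp_pos _
  have hm : Antitone (fun j : ℕ => levelValue su2Rep 1 (oneSiteCoupling β L) j) :=
    KTRCalibration.levelValue_antitone (L := 1) hBpos.le
  -- sort the insertions along the non-increasing rearrangement of `d_ii/n_i`
  obtain ⟨τ, h1, hA, hB⟩ := exists_perm_ordered_position (d := fun i => l2 (ins φ (O i)) (transferApply β (ins φ (O i))))
    (n := fun i => l2 (ins φ (O i)) (ins φ (O i))) (m := fun j : ℕ => levelValue su2Rep 1 (oneSiteCoupling β L) j) h0 hμ0 hl0 hE hm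
    (fun i => (h5 i).1) (fun i => (h5 i).2)
  refine ⟨φ, hφ, hφ1, hKφ, fun i => ins φ (O (τ i)), ⟨fun i => O (τ i), fun i => hO (τ i), rfl⟩, fun i => h0 (τ i), h1,
    fun i l hil => h2 (τ i) (τ l) (fun h => hil (τ.injective h)), fun i => h4 (τ i), fun i => ⟨hA i, hB i⟩,
    fun i l hil => h6 (τ i) (τ l) (fun h => hil (τ.injective h))⟩

end Summit.QuantumFields.YangMills.Theorems.FemtoTransferGap.OpPlat

end
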